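import Mathlib

/-!
# SoloInformed — the unimodular change of basis behind the multiplicity-one torus-surgery lemma,
# and the parity obstruction for the concentric `M1(3)` movie

Context (HKM, arXiv:2402.11706, Question 1.4; soloist notes `work/s38/patterns.md` §4, §8).

(1) Let `R ≅ S¹_α × D²` be a smooth solid torus in a 4-manifold `X`, `T = ∂R`, and use the basis
`(α, β, μ)` of `H₁(∂ν T) = ℤ³` (`α` = core direction, `β` = meridian of `R`, `μ` = meridian of `T`).
A multiplicity-one torus surgery reglues along `σ = μ + m (u α + v β)`.  The proof that every such
surgery returns `X` uses exactly that the integer matrix `ℓ(m,u,v)` with `α ↦ α`, `β ↦ β`, `μ ↦ σ`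
is unimodular (so `(α, σ, β)` is a basis and `ℓ` is realised by a linear diffeomorphism of `T³`
extending over `S¹_α × S¹_μ × D²_β`).  We record `ℓ`, its determinant, its action on the basis
vectors and its inverse.  Coordinates: index `0 = α`, `1 = β`, `2 = μ`.

(2) In the concentric instance of movie class `M1(3)` the first homology of the swept 3-manifold is
`ℤ ⊕ ℤ²/⟨r⟩` with relation vector `r = ((1 - ε), (q - ε x))`, `ε = ±1`, and the slide framing forces
`x = q`.  Then `r ∈ 2ℤ²`, so the quotient is either free of rank 3 (`r = 0`) or has an element of
order two — in either case not `ℤ²`, which kills the instance.  We record the divisibility and the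
general fact that `ℤⁿ/⟨2 r'⟩` has `2`-torsion when `r' ≠ 0`.
-/

namespace Summit.SmoothPoincare4.SmoothPoincare4.Theorems

open Matrix

/-- The change-of-basis matrix `ℓ(m,u,v)`: its columns are the images of `α, β, μ`. -/
def torusSurgeryBasis (m u v : ℤ) : Matrix (Fin 3) (Fin 3) ℤ :=
  !![1, 0, m * u; 0, 1, m * v; 0, 0, 1]

/-- `ℓ(m,u,v)` is unimodular: `det ℓ = 1`. -/
theorem torusSurgeryBasis_det (m u v : ℤ) : (torusSurgeryBasis m u v).det = 1 := by
  simp [torusSurgeryBasis, Matrix.det_fin_three]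

/-- `ℓ` fixes `α`. -/
theorem torusSurgeryBasis_mulVec_alpha (m u v : ℤ) :
    (torusSurgeryBasis m u v).mulVec ![1, 0, 0] = ![1, 0, 0] := by
  ext i; fin_cases i <;> simp [torusSurgeryBasis, Matrix.mulVec, dotProduct, Fin.sum_univ_three]

/-- `ℓ` fixes `β`. -/
theorem torusSurgeryBasis_mulVec_beta (m u v : ℤ) :
    (torusSurgeryBasis m u v).mulVec ![0, 1, 0] = ![0, 1, 0] := by
  ext i; fin_cases i <;> simp [torusSurgeryBasis, Matrix.mulVec, dotProduct, Fin.sum_univ_three]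

/-- `ℓ` sends `μ` to `σ = μ + m(uα + vβ)`, written in coordinates `(α, β, μ)`. -/
theorem torusSurgeryBasis_mulVec_mu (m u v : ℤ) :
    (torusSurgeryBasis m u v).mulVec ![0, 0, 1] = ![m * u, m * v, 1] := by
  ext i; fin_cases i <;> simp [torusSurgeryBasis, Matrix.mulVec, dotProduct, Fin.sum_univ_three]

/-- The inverse of `ℓ(m,u,v)` is `ℓ(-m,u,v)`. -/
theorem torusSurgeryBasis_mul_neg (m u v : ℤ) :
    torusSurgeryBasis m u v * torusSurgeryBasis (-m) u v = 1 := by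
  ext i j
  fin_cases i <;> fin_cases j <;>
    simp [torusSurgeryBasis, Matrix.mul_apply, Fin.sum_univ_three]

/-- `ℓ(m,u,v)` as an element of `SL(3, ℤ)`. -/
def torusSurgeryBasisSL (m u v : ℤ) : Matrix.SpecialLinearGroup (Fin 3) ℤ :=
  ⟨torusSurgeryBasis m u v, torusSurgeryBasis_det m u v⟩

/-- Concentric `M1(3)` instance: with `ε = ±1` and slide framing `x = q`, both coordinates of the
relation vector `((1 - ε), (q - ε x))` are even. -/
theorem concentric_relation_even (ε q x : ℤ) (hε : ε = 1 ∨ ε = -1) (hx : x = q) :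
    2 ∣ (1 - ε) ∧ 2 ∣ (q - ε * x) := by
  subst hx
  rcases hε with h | h <;> subst h <;> constructor
  · simp
  · simp
  · exact ⟨1, by ring⟩
  · exact ⟨x, by ring⟩

/-- If `r' ≠ 0` in `ℤⁿ` then the class of `r'` in `ℤⁿ/⟨2 • r'⟩` is a nonzero element killed by `2`:
the quotient has `2`-torsion (so it is not free abelian). -/
theorem two_torsion_of_double {n : ℕ} (r' : Fin n → ℤ) (hr : r' ≠ 0) :
    (QuotientAddGroup.mk r' : (Fin n → ℤ) ⧸ AddSubgroup.zmultiples ((2 : ℤ) • r')) ≠ 0 ∧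
    (2 : ℕ) • (QuotientAddGroup.mk r' : (Fin n → ℤ) ⧸ AddSubgroup.zmultiples ((2 : ℤ) • r')) = 0 := by
  constructor
  · intro h
    rw [QuotientAddGroup.eq_zero_iff, AddSubgroup.mem_zmultiples_iff] at h
    obtain ⟨k, hk⟩ := h
    obtain ⟨i, hi⟩ := Function.ne_iff.mp hr
    have hi : r' i ≠ 0 := by simpa using hi
    have hki := congrFun hk i
    simp only [Pi.smul_apply, smul_eq_mul] at hki
    have h2 : (2 * k - 1) * r' i = 0 := by linear_combination hki
    rcases mul_eq_zero.mp h2 with h1 | h1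
    · omega
    · exact hi h1
  · rw [← QuotientAddGroup.mk_nsmul, QuotientAddGroup.eq_zero_iff, AddSubgroup.mem_zmultiples_iff]
    exact ⟨1, by simp⟩

end Summit.SmoothPoincare4.SmoothPoincare4.Theorems
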